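import Mathlib
import Summits.ValiantsHypothesis.ValiantsHypothesis.Theorems.LacunarySymmetroidMatrixDescartesDefiniteMoments
import Literature.Computability.AlgebraicComplexity.RealTauKnownCases

/-!
# `MatrixDescartes` (stmt-ValiantsHypothesis-18050) — the DEFINITE-MOMENTS LAW, II: «K alternating definite moments
# ⇒ Z₊ ≤ (K−1)·m» (Descartes' rule with multiplicity `m` on the hyperbolic sector; budget = Descartes on the Rayleigh
# K-nomial)

HONEST FRAMING.  Cell `pub-symmetroid`, seat `val-sym-mdr-p2` (gen 14); helper file `--supports` the crux
`Theses.LacunarySymmetroid.MatrixDescartes`, NO closure claim.  A SECTOR theorem beside the crux; nothing here bears on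
`MatrixDescartes` in its window, on `stub_twoSided`, on `DoorA26`/`DoorA34`, registers, or `VP ≠ VNP`.

THEOREM C (`card_posRoots_le_of_alternatingMoments`).  `F(x) = ∑ₖ x^{dₖ} Sₖ` with ARBITRARY real symmetric `ι × ι`
letters over a letter type with `card κ ≤ V + 1`, any natural exponents.  If `F` is DEFINITE WITH ALTERNATING SIGNS at
`V + 1` scales `0 < a₀ < ⋯ < a_V` (`σ(−1)ʲ·vᵀF(aⱼ)v > 0` for all `v ≠ 0`), then `det F` has at most `V · card ι`
distinct positive zeros — for `K` letters and `K` moments, Descartes' bound `K − 1` for ONE `K`-nomial times the size.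
The budget hypothesis of Theorem B (`…DefiniteMoments.card_posRoots_le_of_definiteMoments`) is discharged by the sparse
Descartes rule on the Rayleigh `K`-nomial `∑ₖ (vᵀSₖv) X^{dₖ}` (`rayleigh_budget`, via the tree's
`Literature.Computability.AlgebraicComplexity.card_roots_toFinset_filter_pos_lt_card_support`), which is non-zero
because it is non-zero at `a₀`.  REMARK (not used, not proved here): the hypothesis forces `vᵀSₖv ≠ 0` of alternating
sign for every `v ≠ 0`, i.e. DEFINITE letters with an alternating sign word — the lacunary form of the hyperbolic class
`𝓗` of [cite: CameronPsarrakos2019, Thm 3] (`z⁺(P) ≤ n·α(P)` for hyperbolic `P`, via Markus 1988 Thm 31.5; recorded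
NOT TYPED in the tree's port `…CameronPsarrakos2019.Rules`).  Here hyperbolicity enters in CERTIFICATE form — the
alternating definite test values that separate the spectral zones — and the zone count is Theorem A's nested-cone
argument, so the file is self-contained given the tree engines.  Sharp: diagonal letters whose diagonal `K`-nomials
have `K − 1` interlaced simple positive roots.  [folklore]; axioms `propext`, `Classical.choice`, `Quot.sound`.
-/

-- layout Summits/ValiantsHypothesis/ValiantsHypothesis forces the duplicated namespace component
set_option linter.dupNamespace false

namespace Summit.ValiantsHypothesis.ValiantsHypothesis.Theorems.LacunarySymmetroidMatrixDescartes

open Polynomial Matrix Finset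
open scoped BigOperators

namespace DefiniteMoments

/-! ## THEOREM C — K alternating definite moments (budget from Descartes' rule on the Rayleigh K-nomial) -/

section Alternating

variable {ι κ : Type} [Fintype ι] [DecidableEq ι] [Fintype κ]

omit [DecidableEq ι] in
/-- The Rayleigh `K`-nomial `∑ₖ (vᵀSₖv)·X^{dₖ}` evaluates to the Rayleigh form. [folklore] -/
theorem eval_rayleighPoly (d : κ → ℕ) (S : κ → Matrix ι ι ℝ) (v : ι → ℝ) (r : ℝ) :
    (∑ k, C (v ⬝ᵥ (S k *ᵥ v)) * (X : ℝ[X]) ^ d k).eval r = v ⬝ᵥ ((∑ k, r ^ d k • S k) *ᵥ v) := by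
  rw [form_eq_sum, Polynomial.eval_finsetSum]
  refine Finset.sum_congr rfl fun k _ => ?_
  rw [Polynomial.eval_mul, Polynomial.eval_C, Polynomial.eval_pow, Polynomial.eval_X, mul_comm]

omit [DecidableEq ι] in
/-- **Descartes budget of the Rayleigh forms.**  If the Rayleigh form of `v` does not vanish identically (here: it is
non-zero at some point `x₀`), it has fewer distinct positive zeros than there are letters: `T.card + 1 ≤ card κ` for
every finite set `T` of positive zeros (sparse Descartes rule on the Rayleigh `K`-nomial). [folklore] -/
theorem rayleigh_budget (d : κ → ℕ) (S : κ → Matrix ι ι ℝ) (v : ι → ℝ) {x₀ : ℝ}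
    (hx₀ : v ⬝ᵥ ((∑ k, x₀ ^ d k • S k) *ᵥ v) ≠ 0) (T : Finset ℝ)
    (hT : ∀ r ∈ T, 0 < r ∧ v ⬝ᵥ ((∑ k, r ^ d k • S k) *ᵥ v) = 0) : T.card + 1 ≤ Fintype.card κ := by
  set P : ℝ[X] := ∑ k, C (v ⬝ᵥ (S k *ᵥ v)) * (X : ℝ[X]) ^ d k with hP
  have hP0 : P ≠ 0 := by
    intro h
    apply hx₀
    rw [← eval_rayleighPoly, ← hP, h, Polynomial.eval_zero]
  have hTsub : T ⊆ P.roots.toFinset.filter (0 < ·) := by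
    intro r hr
    obtain ⟨hr0, hfr⟩ := hT r hr
    refine Finset.mem_filter.2 ⟨?_, hr0⟩
    rw [Multiset.mem_toFinset, Polynomial.mem_roots hP0, Polynomial.IsRoot, hP, eval_rayleighPoly]
    exact hfr
  have h1 := Literature.Computability.AlgebraicComplexity.card_roots_toFinset_filter_pos_lt_card_support hP0
  have h2 : P.support.card ≤ Fintype.card κ := by
    refine (Literature.Computability.AlgebraicComplexity.card_support_sum_le _ _).trans ?_
    calc ∑ k, (C (v ⬝ᵥ (S k *ᵥ v)) * (X : ℝ[X]) ^ d k).support.card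
        ≤ ∑ _k : κ, 1 := Finset.sum_le_sum fun k _ => Polynomial.card_support_C_mul_X_pow_le_one
      _ = Fintype.card κ := by rw [Finset.sum_const, Finset.card_univ, smul_eq_mul, mul_one]
  have h3 := Finset.card_le_card hTsub
  omega

/-- **THEOREM C («K alternating definite moments»; Descartes' rule with multiplicity `card ι` on the hyperbolic
sector).**  `F(x) = ∑ₖ x^{dₖ} Sₖ` with ARBITRARY real symmetric letters over a letter type with `card κ ≤ V + 1`, any
natural exponents.  If there are scales `0 < a₀ < a₁ < ⋯ < a_V` at which `F` is definite with alternating signs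
(`σ(−1)ʲ·vᵀF(aⱼ)v > 0` for `v ≠ 0`), then `det (∑ₖ X^{dₖ} Sₖ)` has at most `V · card ι` distinct positive zeros
(`K` letters, `K` moments: `Z₊ ≤ (K−1)·m`).  The budget is Descartes' (`rayleigh_budget`), the count is Theorem B.
[folklore] (lacunary certificate form of [cite: CameronPsarrakos2019, Thm 3]) -/
theorem card_posRoots_le_of_alternatingMoments (d : κ → ℕ) (S : κ → Matrix ι ι ℝ)
    (hS : ∀ k, (S k).IsSymm) (V : ℕ) (hκ : Fintype.card κ ≤ V + 1) (a : Fin (V + 1) → ℝ) (ha : StrictMono a)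
    (ha0 : 0 < a 0) (σ : ℝ)
    (hdef : ∀ (j : Fin (V + 1)) (v : ι → ℝ), v ≠ 0 →
      0 < σ * (-1) ^ (j : ℕ) * (v ⬝ᵥ ((∑ k, a j ^ d k • S k) *ᵥ v))) :
    ((Matrix.det (∑ k, ((X : ℝ[X]) ^ d k) • (S k).map C)).roots.toFinset.filter
        (fun t => 0 < t)).card ≤ V * Fintype.card ι := by
  refine card_posRoots_le_of_definiteMoments d S hS V a ha ha0 σ hdef fun v hv T hT => ?_
  have hx₀ : v ⬝ᵥ ((∑ k, a 0 ^ d k • S k) *ᵥ v) ≠ 0 := by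
    intro h
    have h0 := hdef 0 v hv
    rw [h, mul_zero] at h0
    exact lt_irrefl 0 h0
  have h := rayleigh_budget d S v hx₀ T hT
  omega

end Alternating

end DefiniteMoments

end Summit.ValiantsHypothesis.ValiantsHypothesis.Theorems.LacunarySymmetroidMatrixDescartes
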